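import Mathlib
import Summits.AtomisticToContinuum.Crystallization.Theorems.PricedLinkCensusStackingHingeFarTail

/-!
# Crux `PatternPricedCertificates` (stmt-AtomisticToContinuum-12974), line `registered`
# (birth skeleton `Lines/birth.lean`), stub `stub_farField` — far-field control

This file proves stub `stub_farField` of line `registered` (birth skeleton) for crux
stmt-AtomisticToContinuum-12974: for every separation `δ > 0` and every `η > 0` there is a level
`L₀` such that for all `L ≥ L₀`, on every finite `δ`-separated configuration `x : Fin N → ℝ³` and
at every particle `i`, the Lennard-Jones energy of `i` with the particles beyond distance `L` is
`≥ -η`, uniformly in `N`.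

PROOF.  `V_LJ(d) = (1/12) d⁻¹² - (1/6) d⁻⁶ ≥ -(1/6) d⁻⁶` for every `d`.  By the far-shell tail
bound `PricedHcpWindowsFarTail.stub_farTail` there is `C = C(δ) ≥ 0` with
`∑_{j ≠ i, |xᵢ - xⱼ| ≥ ℓ} |xᵢ - xⱼ|⁻⁶ ≤ C ℓ⁻³` for all `ℓ ≥ δ`.  Put
`L₀ := max δ (max 1 (C / (6η) + 1))`.  For `L ≥ L₀` the set `{j ≠ i : ¬ |xᵢ - xⱼ| ≤ L}` is
contained in `{j ≠ i : L ≤ |xᵢ - xⱼ|}` and the summands `|xᵢ - xⱼ|⁻⁶` are `≥ 0`, so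
`∑_{j ≠ i, |xᵢ - xⱼ| > L} V_LJ ≥ -(1/6) C L⁻³ ≥ -(1/6) C L⁻¹ ≥ -η` (`L ≥ 1`, `6ηL > C`).
-/

noncomputable section

open scoped BigOperators Classical

namespace Summit.AtomisticToContinuum.Crystallization.Theorems.PatternPricedCertificates

open Literature.MathematicalPhysics.StatisticalMechanics

/-- **Far-field control (stub `stub_farField`).** For every separation `δ > 0` and `η > 0` there
is `L₀` such that for all `L ≥ L₀`, on every finite `δ`-separated configuration of `ℝ³` and at
every particle `i`, `∑_{j ≠ i, |xᵢ - xⱼ| > L} V_LJ(|xᵢ - xⱼ|) ≥ -η`: combine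
`V_LJ(d) ≥ -(1/6) d⁻⁶` with the dyadic-shell tail bound
`∑_{j ≠ i, |xᵢ - xⱼ| ≥ L} |xᵢ - xⱼ|⁻⁶ ≤ C(δ) L⁻³` (`PricedHcpWindowsFarTail.stub_farTail`) and take
`L₀ := max δ (max 1 (C(δ) / (6η) + 1))`. [folklore] -/
theorem stub_farField :
    ∀ δ : ℝ, 0 < δ → ∀ η : ℝ, 0 < η → ∃ L₀ : ℝ, ∀ L : ℝ, L₀ ≤ L →
      ∀ (N : ℕ) (x : Fin N → EuclideanSpace ℝ (Fin 3)), (∀ i j : Fin N, i ≠ j → δ ≤ dist (x i) (x j)) →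
        ∀ i : Fin N, -η ≤ ∑ j ∈ (Finset.univ.erase i).filter (fun j => ¬ dist (x i) (x j) ≤ L),
          Literature.MathematicalPhysics.StatisticalMechanics.lennardJones (dist (x i) (x j)) := by
  intro δ hδ η hη
  obtain ⟨C, hC0, hC⟩ := PricedHcpWindowsFarTail.stub_farTail δ hδ
  refine ⟨max δ (max 1 (C / (6 * η) + 1)), ?_⟩
  intro L hL N x hsep i
  have hδL : δ ≤ L := (le_max_left _ _).trans hL
  have h1L : (1 : ℝ) ≤ L := ((le_max_left _ _).trans (le_max_right _ _)).trans hL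
  have hCL : C / (6 * η) + 1 ≤ L := ((le_max_right _ _).trans (le_max_right _ _)).trans hL
  have hLpos : 0 < L := one_pos.trans_le h1L
  -- the far-shell tail bound at range `L ≥ δ`
  have htail := hC N x hsep i L hδL
  -- `{j ≠ i : ¬ dist ≤ L} ⊆ {j ≠ i : L ≤ dist}`
  have hsub : (Finset.univ.erase i).filter (fun j => ¬ dist (x i) (x j) ≤ L) ⊆
      (Finset.univ.erase i).filter (fun j => L ≤ dist (x i) (x j)) := by
    intro j hj
    rw [Finset.mem_filter] at hj ⊢
    exact ⟨hj.1, (not_le.1 hj.2).le⟩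
  -- termwise lower bound `V_LJ ≥ -(1/6) dist⁻⁶`
  have step1 : ∑ j ∈ (Finset.univ.erase i).filter (fun j => ¬ dist (x i) (x j) ≤ L),
      -((1 / 6) * (dist (x i) (x j))⁻¹ ^ 6) ≤
      ∑ j ∈ (Finset.univ.erase i).filter (fun j => ¬ dist (x i) (x j) ≤ L),
        lennardJones (dist (x i) (x j)) := by
    refine Finset.sum_le_sum fun j _ => ?_
    unfold lennardJones
    have h : 0 ≤ (1 / 12) * ((dist (x i) (x j))⁻¹) ^ 12 := by positivity
    linarith
  -- enlarge the index set (nonnegative summands)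
  have step2 : ∑ j ∈ (Finset.univ.erase i).filter (fun j => ¬ dist (x i) (x j) ≤ L),
      (dist (x i) (x j))⁻¹ ^ 6 ≤
      ∑ j ∈ (Finset.univ.erase i).filter (fun j => L ≤ dist (x i) (x j)),
        (dist (x i) (x j))⁻¹ ^ 6 :=
    Finset.sum_le_sum_of_subset_of_nonneg hsub fun j _ _ => by positivity
  -- `C L⁻³ ≤ C L⁻¹` since `L ≥ 1`
  have step3 : C * L⁻¹ ^ 3 ≤ C * L⁻¹ := by
    refine mul_le_mul_of_nonneg_left ?_ hC0
    have h0 : 0 ≤ L⁻¹ := inv_nonneg.2 hLpos.le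
    have h1 : L⁻¹ ≤ 1 := inv_le_one_of_one_le₀ h1L
    calc L⁻¹ ^ 3 ≤ L⁻¹ ^ 1 := pow_le_pow_of_le_one h0 h1 (by norm_num)
      _ = L⁻¹ := pow_one _
  -- `C L⁻¹ ≤ 6 η` since `L ≥ C / (6η) + 1`
  have step4 : C * L⁻¹ ≤ 6 * η := by
    rw [← div_eq_mul_inv, div_le_iff₀ hLpos]
    have h6η : (0 : ℝ) < 6 * η := by positivity
    have h : C / (6 * η) ≤ L := by linarith
    rw [div_le_iff₀ h6η] at h
    linarith
  rw [Finset.sum_neg_distrib, ← Finset.mul_sum] at step1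
  linarith [step1, step2, step3, step4, htail]

end Summit.AtomisticToContinuum.Crystallization.Theorems.PatternPricedCertificates

end
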